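import Mathlib
import Summits.AtomisticToContinuum.HydrodynamicLimit.Theorems.ImplosionDichotomyDenseExcursionSonicCavityDefs

/-!
# Uniqueness half of `stub_cavityResolvent` (crux `DenseExcursion`, line `sonic-cavity-renewal`)

Helper file (`--supports stmt-AtomisticToContinuum-12586`, line lead a2, stub-worker for `stub_cavityResolvent`) for the
registered skeleton `Cruxes/DenseExcursion/Lines/sonic_cavity_renewal.lean` of the crux
`Summit.AtomisticToContinuum.HydrodynamicLimit.Theses.ImplosionDichotomy.DenseExcursion`.

The stub `stub_cavityResolvent` asks, on the pinned window `17307/15625 ≤ r ≤ 89409/80000`, for `CavityResolvent r W S`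
(`…SonicCavityDefs`): existence, a uniform weighted-sup bound, and UNIQUENESS on the core `x ≤ 1` of smooth centre-regular
solutions of the resolvent equation `Λ ŵ − linW(ŵ, ŝ) = f`, `Λ ŝ − linS(ŵ, ŝ) = g` for `Λ` in the closed half-plane
`Re Λ ≥ −1/5` outside the `1/20`-discs around `0`, `Λ₁`, `r`. This file lands the uniqueness half (pure logic over the
box package), in fact uniqueness on ALL of `ℝ`:

* `isRegularPair_sub`, `linW_sub`, `linS_sub` — centre-regular pairs are closed under subtraction and `L = (linW, linS)` is
  linear, so the difference of two solutions with the same source solves the HOMOGENEOUS equations;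
* `rate_eq_of_window` (registered helper) — on the pinned window (`r ≤ 89409/80000 < 9/8`, so `9(r−1) < r`) ANY real rate
  `Λ₁ ∈ (6(r−1), 9(r−1))` carrying a smooth radial mode is THE package rate: box exclusivity (`BoxPackage`) applied to `Λ₁`
  itself (it lies in the box: `0 < Λ₁ < 2 ≤ boxSide`, `Im Λ₁ = 0`) gives `Λ₁ ∈ {Λ₁⁰, r, 0}`, and `Λ₁ = r`, `Λ₁ = 0` are
  excluded by the window; hence the strip exclusivity `Λ ∈ {Λ₁, r, 0}` holds for every smooth radial mode with `Re Λ > −1/4`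
  (`RealBound`, `SonicConfinement` put it in the box, as in `strip_quarter_of_box`);
* `cavityResolvent_unique` (registered helper) — if the difference of two centre-regular solutions were not identically zero it
  would be a smooth radial mode with rate `Λ`, `Re Λ ≥ −1/5 > −1/4`, so `Λ ∈ {Λ₁, r, 0}` — each excluded by one of the three
  disc conditions `‖Λ‖, ‖Λ − Λ₁‖, ‖Λ − r‖ ≥ 1/20`.

NOT here: the existence + uniform-bound half of `CavityResolvent` (see the worker report `stub_cavityResolvent.REPORT.md`:
as typed — weighted `C⁰` source norm → weighted `C⁰` solution norm — that half FAILS at the repulsive sonic point, where the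
smooth branch has Frobenius exponent `ν(Λ) = (4 − 2r − κ − Λ)/κ` with `Re ν > 0` on the whole region; the source norm must
carry `k > Re ν(−1/5)` derivatives).
-/

noncomputable section

open scoped ContDiff

namespace Summit.AtomisticToContinuum.HydrodynamicLimit.Theorems.SonicCavityRenewal

open Summit.AtomisticToContinuum.HydrodynamicLimit.Theorems.R2OneModeTwoConditions

/-! ## Linearity: regular pairs and `L = (linW, linS)` under subtraction -/

/-- Centre-regular smooth pairs are closed under subtraction: subtract the smooth extensions `F₁, F₂, G₁, G₂` of the
radial fields. [folklore] -/
theorem isRegularPair_sub {ŵ ŝ ŵ' ŝ' : ℝ → ℂ} (h : IsRegularPair ŵ ŝ) (h' : IsRegularPair ŵ' ŝ') :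
    IsRegularPair (fun x => ŵ' x - ŵ x) (fun x => ŝ' x - ŝ x) := by
  obtain ⟨hw, hs, F₁, F₂, G₁, G₂, hF₁, hF₂, hG₁, hG₂, hFG⟩ := h
  obtain ⟨hw', hs', F₁', F₂', G₁', G₂', hF₁', hF₂', hG₁', hG₂', hFG'⟩ := h'
  refine ⟨hw'.sub hw, hs'.sub hs, fun y => F₁' y - F₁ y, fun y => F₂' y - F₂ y, fun y => G₁' y - G₁ y,
    fun y => G₂' y - G₂ y, hF₁'.sub hF₁, hF₂'.sub hF₂, hG₁'.sub hG₁, hG₂'.sub hG₂, fun y hy => ?_⟩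
  obtain ⟨h1, h2, h3, h4⟩ := hFG y hy
  obtain ⟨h1', h2', h3', h4'⟩ := hFG' y hy
  refine ⟨?_, ?_, ?_, ?_⟩
  · rw [Complex.sub_re, sub_smul, h1, h1']
  · rw [Complex.sub_im, sub_smul, h2, h2']
  · rw [Complex.sub_re, mul_sub, h3, h3']
  · rw [Complex.sub_im, mul_sub, h4, h4']

/-- `linW` is linear: on differentiable pairs, `linW (ŵ' − ŵ, ŝ' − ŝ) = linW (ŵ', ŝ') − linW (ŵ, ŝ)`. [folklore] -/
theorem linW_sub {r : ℝ} {W S : ℝ → ℝ} {ŵ ŝ ŵ' ŝ' : ℝ → ℂ} (hw : Differentiable ℝ ŵ) (hs : Differentiable ℝ ŝ)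
    (hw' : Differentiable ℝ ŵ') (hs' : Differentiable ℝ ŝ') (x : ℝ) :
    linW r W S (fun y => ŵ' y - ŵ y) (fun y => ŝ' y - ŝ y) x = linW r W S ŵ' ŝ' x - linW r W S ŵ ŝ x := by
  unfold linW
  rw [deriv_fun_sub (hw' x) (hw x), deriv_fun_sub (hs' x) (hs x)]
  ring

/-- `linS` is linear: on differentiable pairs, `linS (ŵ' − ŵ, ŝ' − ŝ) = linS (ŵ', ŝ') − linS (ŵ, ŝ)`. [folklore] -/
theorem linS_sub {r : ℝ} {W S : ℝ → ℝ} {ŵ ŝ ŵ' ŝ' : ℝ → ℂ} (hw : Differentiable ℝ ŵ) (hs : Differentiable ℝ ŝ)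
    (hw' : Differentiable ℝ ŵ') (hs' : Differentiable ℝ ŝ') (x : ℝ) :
    linS r W S (fun y => ŵ' y - ŵ y) (fun y => ŝ' y - ŝ y) x = linS r W S ŵ' ŝ' x - linS r W S ŵ ŝ x := by
  unfold linS
  rw [deriv_fun_sub (hw' x) (hw x), deriv_fun_sub (hs' x) (hs x)]
  ring

/-- The difference of two centre-regular solutions of the resolvent equation with the same source `(f, g)` is either
identically zero or a smooth radial mode with rate `Λ`. [folklore] -/
theorem isSmoothRadialMode_sub_of_solutions {r : ℝ} {W S : ℝ → ℝ} {Λ : ℂ} {f g ŵ ŝ ŵ' ŝ' : ℝ → ℂ}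
    (hreg : IsRegularPair ŵ ŝ) (hreg' : IsRegularPair ŵ' ŝ')
    (hsol : ∀ x, Λ * ŵ x - linW r W S ŵ ŝ x = f x ∧ Λ * ŝ x - linS r W S ŵ ŝ x = g x)
    (hsol' : ∀ x, Λ * ŵ' x - linW r W S ŵ' ŝ' x = f x ∧ Λ * ŝ' x - linS r W S ŵ' ŝ' x = g x)
    (hne : ∃ x, ŵ' x - ŵ x ≠ 0 ∨ ŝ' x - ŝ x ≠ 0) :
    IsSmoothRadialMode r W S Λ (fun x => ŵ' x - ŵ x) (fun x => ŝ' x - ŝ x) := by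
  refine ⟨isRegularPair_sub hreg hreg', hne, fun x => ?_⟩
  have hw : Differentiable ℝ ŵ := hreg.1.differentiable (by simp)
  have hs : Differentiable ℝ ŝ := hreg.2.1.differentiable (by simp)
  have hw' : Differentiable ℝ ŵ' := hreg'.1.differentiable (by simp)
  have hs' : Differentiable ℝ ŝ' := hreg'.2.1.differentiable (by simp)
  rw [linW_sub hw hs hw' hs', linS_sub hw hs hw' hs']
  obtain ⟨e1, e2⟩ := hsol x
  obtain ⟨e1', e2'⟩ := hsol' x
  constructor
  · linear_combination e1' - e1
  · linear_combination e2' - e2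

/-! ## The window rate is the package rate -/

/-- **Registered helper `rate_eq_of_window`: ON THE PINNED WINDOW THE MODE-CARRYING RATE IS UNIQUE.** If `r ≤ 89409/80000`
(so `9(r−1) < r`) and the box package, the real-part bound and the `|Im Λ|`-confinement hold, then for ANY real
`Λ₁ ∈ (6(r−1), 9(r−1))` carrying a smooth radial mode, every smooth radial mode with `Re Λ > −1/4` has `Λ ∈ {Λ₁, r, 0}`:
both `Λ₁` and `Λ` lie in the box (`RealBound`, `SonicConfinement`; `Λ₁` is real with `0 < Λ₁ < 2`), box exclusivity gives
`Λ₁, Λ ∈ {Λ₁⁰, r, 0}` for the package rate `Λ₁⁰`, and `Λ₁ ∉ {r, 0}` by the window. [folklore] -/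
theorem rate_eq_of_window : ∀ (r : ℝ) (W S : ℝ → ℝ), r ≤ 89409 / 80000 → BoxPackage r W S → RealBound r W S → SonicConfinement r W S → ∀ Λ₁ : ℝ, 6 * (r - 1) < Λ₁ → Λ₁ < 9 * (r - 1) → (∃ ŵ ŝ : ℝ → ℂ, IsSmoothRadialMode r W S (Λ₁ : ℂ) ŵ ŝ) → ∀ Λ : ℂ, -(1 / 4 : ℝ) < Λ.re → (∃ ŵ ŝ : ℝ → ℂ, IsSmoothRadialMode r W S Λ ŵ ŝ) → Λ = (Λ₁ : ℂ) ∨ Λ = (r : ℂ) ∨ Λ = 0 := by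
  intro r W S hr9 hbox hre him Λ₁ h6 h9 hmode Λ hΛ hex
  obtain ⟨Λ₀, -, -, -, -, hexcl, -, -⟩ := hbox
  have hr1 : 1 < r := by linarith
  have h1pos : 0 < Λ₁ := by linarith
  -- `Λ₁` lies in the box
  have hbox1 : InBox (Λ₁ : ℂ) := by
    refine ⟨?_, ?_, ?_⟩
    · rw [Complex.ofReal_re]; linarith
    · rw [Complex.ofReal_re, boxSide]; linarith
    · rw [Complex.ofReal_im, abs_zero, boxTop]; norm_num
  -- hence it is the package rate
  have h10 : Λ₁ = Λ₀ := by
    rcases hexcl (Λ₁ : ℂ) hbox1 hmode with h | h | h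
    · exact_mod_cast h
    · have : Λ₁ = r := by exact_mod_cast h
      linarith
    · have : Λ₁ = 0 := by exact_mod_cast h
      linarith
  -- `Λ` lies in the box
  obtain ⟨ŵ, ŝ, hm⟩ := hex
  have hbox2 : InBox Λ := ⟨hΛ, hre Λ ŵ ŝ hm, him Λ ŵ ŝ hm hΛ (hre Λ ŵ ŝ hm)⟩
  rw [h10]
  exact hexcl Λ hbox2 ⟨ŵ, ŝ, hm⟩

/-! ## Uniqueness of centre-regular solutions of the resolvent equation -/

/-- **Registered helper `cavityResolvent_unique`: THE UNIQUENESS HALF OF `stub_cavityResolvent`.** On the pinned window, under the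
box package, the real-part bound and the `|Im Λ|`-confinement: for the window rate `Λ₁` (carrying a smooth mode) and every `Λ` with
`Re Λ ≥ −1/5`, `‖Λ‖ ≥ 1/20`, `‖Λ − Λ₁‖ ≥ 1/20`, `‖Λ − r‖ ≥ 1/20`, two centre-regular smooth solutions `(ŵ, ŝ)`, `(ŵ', ŝ')` of the
resolvent equation `Λ ŵ − linW = f`, `Λ ŝ − linS = g` with the same source coincide EVERYWHERE (a fortiori on `x ≤ 1`): otherwise
their difference is a smooth radial mode with rate `Λ` (`isSmoothRadialMode_sub_of_solutions`), `Re Λ > −1/4`, so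
`Λ ∈ {Λ₁, r, 0}` (`rate_eq_of_window`), contradicting one of the three disc conditions. (The hypotheses `17307/15625 ≤ r`,
`IsMonatomicProfile`, `CavityTube` of the stub are carried but not used.) [folklore] -/
theorem cavityResolvent_unique : ∀ (r : ℝ) (W S : ℝ → ℝ), (17307 / 15625 : ℝ) ≤ r → r ≤ 89409 / 80000 → IsMonatomicProfile r W S → CavityTube r W S → BoxPackage r W S → RealBound r W S → SonicConfinement r W S → ∀ Λ₁ : ℝ, 6 * (r - 1) < Λ₁ → Λ₁ < 9 * (r - 1) → (∃ ŵ ŝ : ℝ → ℂ, IsSmoothRadialMode r W S (Λ₁ : ℂ) ŵ ŝ) → ∀ Λ : ℂ, -(1 / 5 : ℝ) ≤ Λ.re → (1 / 20 : ℝ) ≤ ‖Λ‖ → (1 / 20 : ℝ) ≤ ‖Λ - (Λ₁ : ℂ)‖ → (1 / 20 : ℝ) ≤ ‖Λ - (r : ℂ)‖ → ∀ (f g ŵ ŝ ŵ' ŝ' : ℝ → ℂ), IsRegularPair ŵ ŝ → IsRegularPair ŵ' ŝ' → (∀ x, Λ * ŵ x - linW r W S ŵ ŝ x = f x ∧ Λ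 * ŝ x - linS r W S ŵ ŝ x = g x) → (∀ x, Λ * ŵ' x - linW r W S ŵ' ŝ' x = f x ∧ Λ * ŝ' x - linS r W S ŵ' ŝ' x = g x) → ∀ x, ŵ' x = ŵ x ∧ ŝ' x = ŝ x := by
  intro r W S _ hr9 _ _ hbox hre him Λ₁ h6 h9 hmode Λ hΛre hΛ0 hΛ1 hΛr f g ŵ ŝ ŵ' ŝ' hreg hreg' hsol hsol'
  by_contra hne
  have hex : ∃ x, ŵ' x - ŵ x ≠ 0 ∨ ŝ' x - ŝ x ≠ 0 := by
    by_contra h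
    push Not at h
    exact hne fun x => ⟨sub_eq_zero.1 (h x).1, sub_eq_zero.1 (h x).2⟩
  have hm : IsSmoothRadialMode r W S Λ (fun x => ŵ' x - ŵ x) (fun x => ŝ' x - ŝ x) :=
    isSmoothRadialMode_sub_of_solutions hreg hreg' hsol hsol' hex
  have hΛ : -(1 / 4 : ℝ) < Λ.re := by linarith
  rcases rate_eq_of_window r W S hr9 hbox hre him Λ₁ h6 h9 hmode Λ hΛ ⟨_, _, hm⟩ with h | h | h
  · rw [h, sub_self, norm_zero] at hΛ1
    linarith
  · rw [h, sub_self, norm_zero] at hΛr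
    linarith
  · rw [h, norm_zero] at hΛ0
    linarith

end Summit.AtomisticToContinuum.HydrodynamicLimit.Theorems.SonicCavityRenewal

end
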